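import Summits.Schanuel.Schanuel.Theorems.ZilberEacAxisLogLimits
import HarnessLib

/-!
# The axis `x₂ = r₀x₀ + c` (`0 < r₀(deg F₀ + 1) < 1`): exponential points by the
# LOGARITHMIC-FIBRE regime

Zilber's Exponential-Algebraic Closedness, case ladder (host summit Schanuel, cell `pub-schanuel`,
seat 2, gen 15; HANDOFF O60 (i)).  Family
`W = {x₂ = r₀x₀ + c, y₀ = x₀ + y₂F₀(y₂), y₁ = x₁ + y₂F₁(y₂)} ⊆ ℂ³ × ℂ³`
(`Fⱼ = Σ_{i<eⱼ} A_{j,i}uⁱ`, `a₁ = A_{1,e₁−1} ≠ 0`, `0 < r₀`, `r₀e₀ < 1`).  ANSATZ (labels `m` and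
`k ≍ m^β`, `0 < β < r₀e₁`): `x₀ = Log(2πim) + 2πim + u₀` (slow), `y₂ = Y_m e^{r₀u₀}`
(`Y_m = e^{r₀(Log(2πim)+2πim) + c}`), and the DECOUPLED second fibre on its logarithmic branch
`x₁ = Log(a₁Y_m^{e₁}) + 2πik + u₁`.  Dividing the fibre equations by `2πim` resp. `a₁Y_m^{e₁}`:

  `e^{u₀} − 1 − ν₁ − μ₁u₀ − θ Σ_{i<e₀} A_{0,i}σ^{e₀−1−i}e^{(i+1)r₀u₀} = 0`,
  `e^{u₁} − q₁ − q₂u₁ − Σ_{i<e₁} (A_{1,i}/a₁)σ^{e₁−1−i}e^{(i+1)r₀u₀} = 0`,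

entire in `(u₀, u₁)` and the six parameters of `ZilberEacAxisLogLimits` (all `→ 0`); at zero the
system is `(e^{u₀} − 1, e^{u₁} − e^{e₁r₀u₀})` with invertible derivative `(w₀, w₁ − r₀e₁w₀)`, so
the implicit function theorem (`exists_implicit_of_injective_partial`, gen 13) gives `u → 0`.

* **`exists_solutions_axisLog`** — the solutions with `x₀ = Log(2πim) + 2πim + u₀`,
  `x₁ = Log(a₁Y_m^{e₁}) + 2πik_m + u₁`, `k_m ∈ [m^β, m^β + 1]`, `u → 0`, and eventually both fibre
  equations `e^{xⱼ} = xⱼ + y₂Σ_{i<eⱼ}A_{j,i}y₂ⁱ`, `y₂ = e^{r₀x₀ + c}`.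

HONEST FRAMING: explicit members of an OPEN cell (`ECCell 3 2`); NOT Schanuel's conjecture;
EAC ⇏ SC.
-/

noncomputable section

open Complex Filter Topology

set_option linter.dupNamespace false

namespace Summit.Schanuel.Schanuel.Theorems

section AxisLog

/-- **THEOREM (exponential points on the axis, logarithmic-fibre regime).**  See the module
docstring. (new) [cite: MantovaMasser2023, §1 p.5 (the open case dim π(V) = 2 in ℂ³×ℂˣ³)] -/
theorem exists_solutions_axisLog (e₀ e₁ : ℕ) (he₁ : 1 ≤ e₁) (A : Fin 2 → ℕ → ℂ)
    (ha₁ : A 1 (e₁ - 1) ≠ 0) (r₀ : ℝ) (hr₀ : 0 < r₀) (he₀ : r₀ * e₀ < 1) (c : ℂ)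
    {β : ℝ} (hβ : 0 < β) (hβ₁ : β < r₀ * e₁) :
    ∃ (k : ℕ → ℕ) (x : ℕ → Fin 2 → ℂ) (u : ℕ → ℂ × ℂ),
      (∀ m : ℕ, (m : ℝ) ^ β ≤ (k m : ℝ) ∧ (k m : ℝ) ≤ (m : ℝ) ^ β + 1) ∧
      Tendsto u atTop (𝓝 0) ∧
      (∀ m, x m 0 = Complex.log (2 * Real.pi * I * (m : ℂ)) + 2 * Real.pi * I * (m : ℂ) + (u m).1) ∧
      (∀ m, x m 1 = Complex.log (A 1 (e₁ - 1) * exp ((r₀ : ℂ) *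
          (Complex.log (2 * Real.pi * I * (m : ℂ)) + 2 * Real.pi * I * (m : ℂ)) + c) ^ e₁) +
        2 * Real.pi * I * (k m : ℂ) + (u m).2) ∧
      (∀ m, ∑ i, ((![r₀, 0] : Fin 2 → ℝ) i : ℂ) * x m i + c = (r₀ : ℂ) * x m 0 + c) ∧
      ∀ᶠ m in atTop,
        exp (x m 0) = x m 0 + exp (∑ i, ((![r₀, 0] : Fin 2 → ℝ) i : ℂ) * x m i + c) *
            ∑ i ∈ Finset.range e₀, A 0 i *
              (exp (∑ i, ((![r₀, 0] : Fin 2 → ℝ) i : ℂ) * x m i + c)) ^ i ∧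
        exp (x m 1) = x m 1 + exp (∑ i, ((![r₀, 0] : Fin 2 → ℝ) i : ℂ) * x m i + c) *
            ∑ i ∈ Finset.range e₁, A 1 i *
              (exp (∑ i, ((![r₀, 0] : Fin 2 → ℝ) i : ℂ) * x m i + c)) ^ i := by
  -- constants
  have h2πI : (2 * Real.pi * I : ℂ) ≠ 0 := Complex.two_pi_I_ne_zero
  obtain ⟨a₁, ha₁def⟩ : ∃ a₁ : ℂ, a₁ = A 1 (e₁ - 1) := ⟨_, rfl⟩
  have ha₁0 : a₁ ≠ 0 := by rw [ha₁def]; exact ha₁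
  have htop : (((e₁ - 1 : ℕ) : ℂ) + 1) = (e₁ : ℂ) := by
    rw [Nat.cast_sub he₁]; push_cast; ring
  -- the free second label `k ≍ m^β`
  obtain ⟨k, hkdef⟩ : ∃ k : ℕ → ℕ, k = fun m : ℕ => ⌈(m : ℝ) ^ β⌉₊ := ⟨_, rfl⟩
  have hk : ∀ m : ℕ, (m : ℝ) ^ β ≤ (k m : ℝ) ∧ (k m : ℝ) ≤ (m : ℝ) ^ β + 1 := by
    intro m
    rw [hkdef]
    exact ⟨Nat.le_ceil _, (Nat.ceil_lt_add_one (by positivity)).le⟩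
  obtain ⟨K, hKdef⟩ : ∃ K : ℕ → ℝ, K = fun m => (k m : ℝ) := ⟨_, rfl⟩
  have hK : ∀ m : ℕ, (m : ℝ) ^ β ≤ K m ∧ K m ≤ (m : ℝ) ^ β + 1 := by
    intro m; rw [hKdef]; exact hk m
  -- the six parameters tend to zero
  have hν₁ := tendsto_param_nu₁
  have hμ₁ := tendsto_param_mu₁
  have hθ := tendsto_axis_theta hβ hK c e₀ he₀
  have hσ := tendsto_axis_sigma hβ hK hr₀ c
  have hq₁ := tendsto_axis_q₁ hβ hK hr₀ c ha₁0 e₁ he₁ hβ₁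
  have hq₂ := tendsto_axis_q₂ hβ hK hr₀ c ha₁0 e₁ he₁
  have hprt := hν₁.prodMk_nhds (hμ₁.prodMk_nhds (hθ.prodMk_nhds (hσ.prodMk_nhds
    (hq₁.prodMk_nhds hq₂))))
  rw [show (((0 : ℂ), (0 : ℂ), (0 : ℂ), (0 : ℂ), (0 : ℂ), (0 : ℂ)) :
    ℂ × ℂ × ℂ × ℂ × ℂ × ℂ) = 0 from rfl] at hprt
  -- the rescaled system: parameters `(ν₁, μ₁, θ, σ, q₁, q₂)`, unknowns `(u₀, u₁)`
  set f : (ℂ × ℂ × ℂ × ℂ × ℂ × ℂ) × (ℂ × ℂ) → ℂ × ℂ := fun w =>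
    (exp w.2.1 - 1 - w.1.1 - w.1.2.1 * w.2.1 -
        w.1.2.2.1 * ∑ i ∈ Finset.range e₀, A 0 i * w.1.2.2.2.1 ^ (e₀ - 1 - i) *
          exp ((((i : ℕ) : ℂ) + 1) * ((r₀ : ℂ) * w.2.1)),
      exp w.2.2 - w.1.2.2.2.2.1 - w.1.2.2.2.2.2 * w.2.2 -
        ∑ i ∈ Finset.range e₁, A 1 i / a₁ * w.1.2.2.2.1 ^ (e₁ - 1 - i) *
          exp ((((i : ℕ) : ℂ) + 1) * ((r₀ : ℂ) * w.2.1))) with hf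
  have hfC : ContDiff ℂ 1 f := by
    rw [hf]
    fun_prop
  -- at zero parameters only the top term of the second sum survives
  have hsum0 : ∀ v : ℂ, ∑ i ∈ Finset.range e₁, A 1 i / a₁ * (0 : ℂ) ^ (e₁ - 1 - i) *
      exp ((((i : ℕ) : ℂ) + 1) * ((r₀ : ℂ) * v)) = exp ((e₁ : ℂ) * ((r₀ : ℂ) * v)) := by
    intro v
    rw [Finset.sum_eq_single (e₁ - 1)]
    · rw [Nat.sub_self, pow_zero, mul_one, htop, ha₁def, div_self ha₁, one_mul]
    · intro i hi hne
      have hi' : i < e₁ := Finset.mem_range.1 hi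
      rw [zero_pow (by omega), mul_zero, zero_mul]
    · intro h
      exact absurd (Finset.mem_range.2 (by omega)) h
  have eqf : (fun q' : ℂ × ℂ => f (0, q')) =
      fun q' => (exp q'.1 - 1, exp q'.2 - exp ((e₁ : ℂ) * ((r₀ : ℂ) * q'.1))) := by
    funext q'
    simp only [hf, Prod.fst_zero, Prod.snd_zero, sub_zero, zero_mul, hsum0]
  have hfq : f (0, 0) = 0 := by
    have := congrFun eqf 0
    rw [this]
    simp
  set L : (ℂ × ℂ) →L[ℂ] (ℂ × ℂ) :=
    (ContinuousLinearMap.fst ℂ ℂ ℂ).prod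
      (ContinuousLinearMap.snd ℂ ℂ ℂ - ((e₁ : ℂ) * (r₀ : ℂ)) • ContinuousLinearMap.fst ℂ ℂ ℂ) with hL
  have hLderiv : HasFDerivAt (fun q' : ℂ × ℂ => f (0, q')) L 0 := by
    rw [eqf]
    have ha : HasFDerivAt (fun q' : ℂ × ℂ => q'.1) (ContinuousLinearMap.fst ℂ ℂ ℂ) 0 :=
      hasFDerivAt_fst
    have hb : HasFDerivAt (fun q' : ℂ × ℂ => q'.2) (ContinuousLinearMap.snd ℂ ℂ ℂ) 0 :=
      hasFDerivAt_snd
    have hc : HasFDerivAt (fun q' : ℂ × ℂ => (e₁ : ℂ) * ((r₀ : ℂ) * q'.1))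
        (((e₁ : ℂ) * (r₀ : ℂ)) • ContinuousLinearMap.fst ℂ ℂ ℂ) 0 := by
      have := (ha.const_mul (r₀ : ℂ)).const_mul (e₁ : ℂ)
      refine this.congr_fderiv ?_
      ext <;> simp
    refine ((ha.cexp.sub_const 1).prodMk (hb.cexp.sub hc.cexp)).congr_fderiv ?_
    rw [hL]
    ext <;> simp
  have hinj : Function.Injective L := by
    refine (injective_iff_map_eq_zero _).2 fun w hw => ?_
    rw [hL] at hw
    have hw' : w.1 = 0 ∧ w.2 - (e₁ : ℂ) * (r₀ : ℂ) * w.1 = 0 := by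
      simpa [Prod.ext_iff, smul_eq_mul, mul_assoc] using hw
    refine Prod.ext hw'.1 ?_
    have := hw'.2
    rw [hw'.1, mul_zero, sub_zero] at this
    exact this
  -- the implicit function and the solutions
  obtain ⟨ψ, hψsol, hψlim⟩ := exists_implicit_of_injective_partial hfC hfq hLderiv hinj
  set Y : ℕ → ℂ := fun m => exp ((r₀ : ℂ) * (Complex.log (2 * Real.pi * I * (m : ℂ)) +
    2 * Real.pi * I * (m : ℂ)) + c) with hY
  set pr : ℕ → ℂ × ℂ × ℂ × ℂ × ℂ × ℂ := fun m =>
    ((2 * Real.pi * I * (m : ℂ))⁻¹ * Complex.log (2 * Real.pi * I * (m : ℂ)),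
      (2 * Real.pi * I * (m : ℂ))⁻¹,
      (2 * Real.pi * I * (m : ℂ))⁻¹ * Y m ^ e₀,
      (Y m)⁻¹,
      (Complex.log (a₁ * Y m ^ e₁) + 2 * Real.pi * I * (K m : ℂ)) * (a₁ * Y m ^ e₁)⁻¹,
      (a₁ * Y m ^ e₁)⁻¹) with hpr
  have hprt' : Tendsto pr atTop (𝓝 0) := hprt
  have hulim : Tendsto (fun m => ψ (pr m)) atTop (𝓝 0) := hψlim.comp hprt'
  have hsol : ∀ᶠ m in atTop, f (pr m, ψ (pr m)) = 0 := hprt'.eventually hψsol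
  set x : ℕ → Fin 2 → ℂ := fun m =>
    ![Complex.log (2 * Real.pi * I * (m : ℂ)) + 2 * Real.pi * I * (m : ℂ) + (ψ (pr m)).1,
      Complex.log (a₁ * Y m ^ e₁) + 2 * Real.pi * I * (k m : ℂ) + (ψ (pr m)).2] with hx
  have hℓ : ∀ m, ∑ i, ((![r₀, 0] : Fin 2 → ℝ) i : ℂ) * x m i + c = (r₀ : ℂ) * x m 0 + c := by
    intro m
    rw [Fin.sum_univ_two]
    simp only [Matrix.cons_val_zero, Matrix.cons_val_one, Complex.ofReal_zero, zero_mul, add_zero]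
  refine ⟨k, x, fun m => ψ (pr m), hk, hulim, fun m => ?_, fun m => ?_, hℓ, ?_⟩
  · simp only [hx, Matrix.cons_val_zero]
  · simp only [hx, Matrix.cons_val_one, Matrix.cons_val_zero]
    rw [ha₁def]
  filter_upwards [hsol, eventually_ge_atTop 1] with m hm hm1
  -- nonvanishing facts for this `m`
  have hmC : (m : ℂ) ≠ 0 := by exact_mod_cast (show m ≠ 0 by omega)
  have h2πim : (2 * Real.pi * I * (m : ℂ)) ≠ 0 := mul_ne_zero h2πI hmC
  have hY0 : Y m ≠ 0 := Complex.exp_ne_zero _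
  have hT0 : a₁ * Y m ^ e₁ ≠ 0 := mul_ne_zero ha₁0 (pow_ne_zero _ hY0)
  -- opaque atoms
  obtain ⟨Λ₀, hΛ₀⟩ : ∃ Λ : ℂ, Complex.log (2 * Real.pi * I * (m : ℂ)) = Λ := ⟨_, rfl⟩
  obtain ⟨Yv, hYv⟩ : ∃ Yv : ℂ, Y m = Yv := ⟨_, rfl⟩
  obtain ⟨Λ₁, hΛ₁⟩ : ∃ Λ : ℂ, Complex.log (a₁ * Yv ^ e₁) = Λ := ⟨_, rfl⟩
  obtain ⟨u₀, hu₀⟩ : ∃ u₀ : ℂ, (ψ (pr m)).1 = u₀ := ⟨_, rfl⟩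
  obtain ⟨u₁, hu₁⟩ : ∃ u₁ : ℂ, (ψ (pr m)).2 = u₁ := ⟨_, rfl⟩
  obtain ⟨σ, hσ'⟩ : ∃ σ : ℂ, Yv⁻¹ = σ := ⟨_, rfl⟩
  have hYv0 : Yv ≠ 0 := by rw [← hYv]; exact hY0
  have hYσ : Yv * σ = 1 := by rw [← hσ']; exact mul_inv_cancel₀ hYv0
  have hT0' : a₁ * Yv ^ e₁ ≠ 0 := by rw [← hYv]; exact hT0
  -- `y₂ = Yv e^{r₀u₀}` and its powers
  have hx0 : x m 0 = Λ₀ + 2 * Real.pi * I * (m : ℂ) + u₀ := by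
    simp only [hx, Matrix.cons_val_zero]; rw [hΛ₀, hu₀]
  have hx1 : x m 1 = Λ₁ + 2 * Real.pi * I * (k m : ℂ) + u₁ := by
    simp only [hx, Matrix.cons_val_one, Matrix.cons_val_zero]; rw [hYv, hΛ₁, hu₁]
  have hexpℓ : exp (∑ i, ((![r₀, 0] : Fin 2 → ℝ) i : ℂ) * x m i + c) = Yv * exp ((r₀ : ℂ) * u₀) := by
    rw [hℓ, hx0, ← hYv, hY]
    simp only
    rw [← Complex.exp_add, hΛ₀]
    congr 1
    ring
  have hEpow : ∀ i : ℕ, (Yv * exp ((r₀ : ℂ) * u₀)) ^ (i + 1) =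
      Yv ^ (i + 1) * exp ((((i : ℕ) : ℂ) + 1) * ((r₀ : ℂ) * u₀)) := by
    intro i
    rw [mul_pow]
    congr 1
    rw [← Complex.exp_nat_mul, Nat.cast_succ]
  -- the fibre sums
  obtain ⟨R₀, hR₀⟩ : ∃ R : ℂ, (∑ i ∈ Finset.range e₀, A 0 i * σ ^ (e₀ - 1 - i) *
    exp ((((i : ℕ) : ℂ) + 1) * ((r₀ : ℂ) * u₀))) = R := ⟨_, rfl⟩
  obtain ⟨R₁, hR₁⟩ : ∃ R : ℂ, (∑ i ∈ Finset.range e₁, A 1 i / a₁ * σ ^ (e₁ - 1 - i) *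
    exp ((((i : ℕ) : ℂ) + 1) * ((r₀ : ℂ) * u₀))) = R := ⟨_, rfl⟩
  have hW0 : Yv * exp ((r₀ : ℂ) * u₀) * ∑ i ∈ Finset.range e₀, A 0 i * (Yv * exp ((r₀ : ℂ) * u₀)) ^ i =
      Yv ^ e₀ * R₀ := by
    rw [← hR₀, Finset.mul_sum, Finset.mul_sum]
    refine Finset.sum_congr rfl fun i hi => ?_
    have hi' : i < e₀ := Finset.mem_range.1 hi
    rw [show Yv * exp ((r₀ : ℂ) * u₀) * (A 0 i * (Yv * exp ((r₀ : ℂ) * u₀)) ^ i) =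
      A 0 i * (Yv * exp ((r₀ : ℂ) * u₀)) ^ (i + 1) by ring, hEpow i,
      pow_succ_eq_pow_mul_inv_pow hYσ hi']
    ring
  have hW1 : Yv * exp ((r₀ : ℂ) * u₀) * ∑ i ∈ Finset.range e₁, A 1 i * (Yv * exp ((r₀ : ℂ) * u₀)) ^ i =
      a₁ * Yv ^ e₁ * R₁ := by
    rw [← hR₁, Finset.mul_sum, Finset.mul_sum]
    refine Finset.sum_congr rfl fun i hi => ?_
    have hi' : i < e₁ := Finset.mem_range.1 hi
    rw [show Yv * exp ((r₀ : ℂ) * u₀) * (A 1 i * (Yv * exp ((r₀ : ℂ) * u₀)) ^ i) =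
      A 1 i * (Yv * exp ((r₀ : ℂ) * u₀)) ^ (i + 1) by ring, hEpow i,
      pow_succ_eq_pow_mul_inv_pow hYσ hi']
    field_simp
  -- the rescaled equations for this `m`
  have hp1 : (pr m).1 = (2 * Real.pi * I * (m : ℂ))⁻¹ * Λ₀ := by simp only [hpr]; rw [hΛ₀]
  have hp2 : (pr m).2.1 = (2 * Real.pi * I * (m : ℂ))⁻¹ := by simp only [hpr]
  have hp3 : (pr m).2.2.1 = (2 * Real.pi * I * (m : ℂ))⁻¹ * Yv ^ e₀ := by simp only [hpr]; rw [hYv]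
  have hp4 : (pr m).2.2.2.1 = σ := by simp only [hpr]; rw [hYv, hσ']
  have hp5 : (pr m).2.2.2.2.1 = (Λ₁ + 2 * Real.pi * I * (K m : ℂ)) * (a₁ * Yv ^ e₁)⁻¹ := by
    simp only [hpr]; rw [hYv, hΛ₁]
  have hp6 : (pr m).2.2.2.2.2 = (a₁ * Yv ^ e₁)⁻¹ := by simp only [hpr]; rw [hYv]
  have heq := hm
  simp only [hf, Prod.mk_eq_zero] at heq
  rw [hp1, hp2, hp3, hp4, hp5, hp6, hu₀, hu₁, hR₀, hR₁] at heq
  obtain ⟨hq1, hq2⟩ := heq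
  have hμm : (2 * Real.pi * I * (m : ℂ)) * (2 * Real.pi * I * (m : ℂ))⁻¹ = 1 :=
    mul_inv_cancel₀ h2πim
  have hTq : (a₁ * Yv ^ e₁) * (a₁ * Yv ^ e₁)⁻¹ = 1 := mul_inv_cancel₀ hT0'
  have hKk : (2 * Real.pi * I * (K m : ℂ)) = 2 * Real.pi * I * (k m : ℂ) := by
    rw [hKdef]; norm_cast
  -- the exponentials of the coordinates
  have hex0 : exp (x m 0) = 2 * Real.pi * I * (m : ℂ) * exp u₀ := by
    rw [hx0, Complex.exp_add, Complex.exp_add, ← hΛ₀, Complex.exp_log h2πim,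
      show 2 * Real.pi * I * (m : ℂ) = ((m : ℤ) : ℂ) * (2 * Real.pi * I) by push_cast; ring,
      Complex.exp_int_mul_two_pi_mul_I, mul_one]
  have hex1 : exp (x m 1) = a₁ * Yv ^ e₁ * exp u₁ := by
    rw [hx1, Complex.exp_add, Complex.exp_add, ← hΛ₁, Complex.exp_log hT0',
      show 2 * Real.pi * I * (k m : ℂ) = ((k m : ℤ) : ℂ) * (2 * Real.pi * I) by push_cast; ring,
      Complex.exp_int_mul_two_pi_mul_I, mul_one]
  constructor
  · rw [hexpℓ, hW0, hex0, hx0]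
    linear_combination (2 * Real.pi * I * (m : ℂ)) * hq1 + (Λ₀ + u₀ + Yv ^ e₀ * R₀) * hμm
  · rw [hexpℓ, hW1, hex1, hx1, ← hKk]
    linear_combination (a₁ * Yv ^ e₁) * hq2 + (Λ₁ + 2 * Real.pi * I * (K m : ℂ) + u₁) * hTq

end AxisLog

end Summit.Schanuel.Schanuel.Theorems
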